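import Literature.AlgebraicGeometry.Frobenioids.ModelFrobenioidBaseSectionSkeleton
import HarnessLib

/-!
# Frobenioids I, Theorem 5.2, proof (p. 101): base-Frobenius pairs of the model Frobenioid THROUGH
# PRESCRIBED FROBENIUS-TRIVIAL OBJECTS AND A PRESCRIBED PULL-BACK MORPHISM (abc-iut cell, layer L1
# vocabulary; consumer: [EtTh] Prop. 4.2 (iii), sub-node L03 `BaseFrobeniusLift` of
# plan/L2/SUBDAG-EtTh-Prop42.md at the canonical model of the §4 setting)

Mochizuki, *The geometry of Frobenioids I: the general theory*, Kyushu J. Math. **62** (2008)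
293–400, §5, proof of Theorem 5.2, kurims text p. 101 [cite: MochizukiFrdI2008, Thm. 5.2 p.101]:

> "Here, we observe that the objects `A = (A_D, α)` such that `α = 0` are Frobenius-trivial, and that
> these objects, together with the morphisms `φ = (deg_Fr(φ), Base(φ), Div(φ), u_φ) : A → B` such that
> `Div(φ) = 0`, `u_φ = 1`, determine a base-Frobenius pair of `C`."

and Prop. 5.6 (p. 105): for a Frobenius-trivial `A ∈ Ob(P)`, the base-Frobenius pair "determined by
'restricting' `P`, `F` to `A`" is unique "up to conjugation by a unit".

`ModelFrobenioidBaseSection(Skeleton).lean` realise the quoted observation with the objects `(A_D, 0)`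
(over a skeleton of `D`, Def. 2.7 (i)(a)).  A consumer that is HANDED a Frobenius-trivial object `A` —
whose class `α` is then only PRINCIPAL (`α = Div_B(b)`, not `0`) — and a linear morphism `φ : A' → A₀`
with `Div(φ) = 0` between two such objects needs a base-Frobenius pair `(P, F)` with `A', A₀ ∈ Ob(P)`
and `φ` `P`-distinguished ([EtTh] Def. 4.1 (iv)(e) "arise from a base-Frobenius pair", as rendered by
abc-iut-L2-t9's `TemperedFrobenioid.ArisesFromBaseFrobeniusPair`).  This file constructs it: the zero
section CONJUGATED BY A UNIT FAMILY ("trivializations" `t_A ∈ B(A_D)` with `Div_B(t_A) = α`) over a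
system of representatives of the isomorphism classes of `D` pinned at `A₀` and `A'`:
* `twistPresection R t` — objects: a class `R` of principal objects, one over each isomorphism class
  of `D`; morphisms: the linear `(1, f, 0, u)` with `u · f^*(t_B) = t_A` (for `t ≡ 1` and `α = 0` this
  is the zero section); `twistFrob` / `twistFrobHom` / `twistFrobeniusSection` — the Frobenius
  endomorphisms `(n, id, 0, t_A^{n-1})`;
* `isBaseFrobeniusPair_twist` — they form a base-Frobenius pair (Def. 2.7 (iii)) for `Φ` divisorial,
  `B` group-like, whenever `R` picks exactly one object over each isomorphism class of `D`;
* `exists_isBaseFrobeniusPair_through` — **for a linear `φ : A' → A₀` with `Div(φ) = 0` between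
  principal objects whose bases are NOT isomorphic, there is a base-Frobenius pair `(P, F)` with `φ`
  `P`-distinguished**; `exists_isBaseFrobeniusPair_obj` — every principal (e.g. Frobenius-trivial)
  object lies in some base-section; `exists_cls_eq_divB_of_isFrobeniusTrivial` — Frobenius-trivial
  objects are principal.
The restriction "bases not isomorphic (or `φ = id`)" is forced by Def. 2.7 (i)(a) (`P` is a skeleton,
so two objects of `P` with isomorphic bases are EQUAL, `PreFrobenioid.IsBaseSection.eq_of_iso`) —
cf. p. 102 "we may assume without loss of generality that `C` … is a skeleton".
PROOF-ONLY companion in the sense of the cell's discharge rules: the three `def`s are the explicit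
witnesses of an existence proof; no statement of the paper is strengthened; nothing is redefined.
-/

noncomputable section

namespace Literature.AlgebraicGeometry.Frobenioids

namespace ModelFrobenioid

open CategoryTheory Opposite

universe w v u

variable {D : Type u} [Category.{v} D] {Φ B : Dᵒᵖ ⥤ CommMonCat.{w}} {DivB : B ⟶ monoidGp Φ}

/-! ### Frobenius endomorphisms of a principal object -/

/-- Exponent bookkeeping for `(m, id, 0, t^{m-1}) ∘ (n, id, 0, t^{n-1}) = (mn, id, 0, t^{mn-1})`.
[folklore] -/
private theorem pred_add_pred_mul (m n : ℕ+) :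
    ((m : ℕ) - 1) + ((n : ℕ) - 1) * m = (m : ℕ) * n - 1 := by
  obtain ⟨a, ha⟩ : ∃ a, (m : ℕ) = a + 1 := ⟨(m : ℕ) - 1, (Nat.sub_add_cancel (show 1 ≤ (m : ℕ) from m.pos)).symm⟩
  obtain ⟨b, hb⟩ : ∃ b, (n : ℕ) = b + 1 := ⟨(n : ℕ) - 1, (Nat.sub_add_cancel (show 1 ≤ (n : ℕ) from n.pos)).symm⟩
  rw [ha, hb, Nat.add_sub_cancel, Nat.add_sub_cancel,
    show (a + 1) * (b + 1) = a + b * (a + 1) + 1 by ring, Nat.add_sub_cancel]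

variable (t : ∀ X : ModelFrobenioid Φ B DivB, B.obj (op X.base))

/-- The Frobenius endomorphism `(n, id, 0, t_A^{n-1})` of a PRINCIPAL object `A = (A_D, Div_B(t_A))`
(the conjugate by the unit `t_A` of the endomorphism `(n, id, 0, 1)` of `(A_D, 0)` of the proof of
Thm. 5.2). [cite: MochizukiFrdI2008, Thm. 5.2 p.101] -/
def twistFrob (X : ModelFrobenioid Φ B DivB) (hX : X.cls = divB Φ B DivB (op X.base) (t X))
    (n : ℕ+) : X ⟶ X :=
  mkHom X X n (𝟙 _) 1 (t X ^ ((n : ℕ) - 1)) (by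
    rw [map_one, mul_one, pullGp_id, map_pow, ← hX, ← pow_succ', Nat.sub_add_cancel (show 1 ≤ (n : ℕ) from n.pos)])

/-- `(1, id, 0, t^0)` is the identity. [cite: MochizukiFrdI2008, Thm. 5.2 p.101] -/
theorem twistFrob_one (X : ModelFrobenioid Φ B DivB) (hX : X.cls = divB Φ B DivB (op X.base) (t X)) :
    twistFrob t X hX 1 = 𝟙 X :=
  hom_ext rfl rfl rfl (by
    show t X ^ (((1 : ℕ+) : ℕ) - 1) = 1
    rw [PNat.one_coe, Nat.sub_self, pow_zero])

/-- `(mn, id, 0, t^{mn-1}) = (m, id, 0, t^{m-1}) ∘ (n, id, 0, t^{n-1})`.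
[cite: MochizukiFrdI2008, Thm. 5.2 p.101] -/
theorem twistFrob_mul (X : ModelFrobenioid Φ B DivB) (hX : X.cls = divB Φ B DivB (op X.base) (t X))
    (m n : ℕ+) : twistFrob t X hX (m * n) = twistFrob t X hX n ≫ twistFrob t X hX m := by
  refine hom_ext rfl (Category.comp_id _).symm ?_ ?_
  · show (1 : Φ.obj (op X.base)) = pull Φ (𝟙 _) 1 * 1 ^ (m : ℕ)
    rw [map_one, one_pow, mul_one]
  · show t X ^ (((m * n : ℕ+) : ℕ) - 1) = pull B (𝟙 _) (t X ^ ((m : ℕ) - 1)) * (t X ^ ((n : ℕ) - 1)) ^ (m : ℕ)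
    rw [pull_id, ← pow_mul, ← pow_add, pred_add_pred_mul, PNat.mul_coe]

/-- `n ↦ (n, id, 0, t_A^{n-1})` as a homomorphism `ℕ_{≥1} → End_C(A)` (recall `f * g = g ≫ f` in `End`).
[cite: MochizukiFrdI2008, Thm. 5.2 p.101] -/
def twistFrobHom (X : ModelFrobenioid Φ B DivB) (hX : X.cls = divB Φ B DivB (op X.base) (t X)) :
    ℕ+ →* End X where
  toFun n := twistFrob t X hX n
  map_one' := twistFrob_one t X hX
  map_mul' m n := twistFrob_mul t X hX m n

/-- A principal object `(A_D, Div_B(t))` is Frobenius-trivial (Def. 1.2 (iv)): `n ↦ (n, id, 0, t^{n-1})`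
is a section of `deg_Fr` by base-identity endomorphisms of Frobenius type (`B` group-like, so every
morphism of `C` is co-angular). [cite: MochizukiFrdI2008, Thm. 5.2 p.101] -/
theorem isFrobeniusTrivial_of_cls_eq_divB (hBg : Objectwise (fun M _ => IsGroupLike M) B)
    (X : ModelFrobenioid Φ B DivB) (hX : X.cls = divB Φ B DivB (op X.base) (t X)) :
    PreFrobenioid.IsFrobeniusTrivial (toElem Φ B DivB) X :=
  ⟨twistFrobHom t X hX, fun _ =>
    ⟨rfl, rfl, ⟨isCoAngular hBg _, rfl⟩, show IsIso (𝟙 X.base) from inferInstance⟩⟩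

/-- Conversely a Frobenius-trivial object is principal: its base-identity endomorphism of Frobenius
type and degree `2`, `(2, id, 0, u)`, has relation (d) `2α = α + Div_B(u)`, i.e. `α = Div_B(u)`.
[cite: MochizukiFrdI2008, Thm. 5.2 p.101] -/
theorem exists_cls_eq_divB_of_isFrobeniusTrivial (X : ModelFrobenioid Φ B DivB)
    (hX : PreFrobenioid.IsFrobeniusTrivial (toElem Φ B DivB) X) :
    ∃ b : B.obj (op X.base), X.cls = divB Φ B DivB (op X.base) b := by
  obtain ⟨ζ, hζ⟩ := hX
  obtain ⟨hdeg, hbase, ⟨⟨-, hiso⟩, -⟩⟩ := hζ 2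
  have hdeg' : degFr (show X ⟶ X from ζ 2) = 2 := hdeg
  have hbase' : baseMap (show X ⟶ X from ζ 2) = 𝟙 _ := hbase
  have hdiv : div (show X ⟶ X from ζ 2) = 1 := hiso
  have h := rel (show X ⟶ X from ζ 2)
  rw [hdeg', hbase', hdiv, pullGp_id, map_one, mul_one, show ((2 : ℕ+) : ℕ) = 2 from rfl, pow_two] at h
  exact ⟨_, mul_left_cancel h⟩

/-! ### The twisted section over a system of representatives -/

variable (R : ModelFrobenioid Φ B DivB → Prop)

/-- The subcategory `P`: objects a prescribed class `R` (of principal objects, one over each isomorphism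
class of `D`); morphisms the linear `(1, f, 0, u) : A → B` with `u · f^*(t_B) = t_A` — the conjugate of
the zero section `(1, f, 0, 1)` by the units `t`. [cite: MochizukiFrdI2008, Thm. 5.2 p.101] -/
def twistPresection : Presection (ModelFrobenioid Φ B DivB) where
  obj X := R X
  hom {X Y} φ := R X ∧ R Y ∧ degFr φ = 1 ∧ div φ = 1 ∧ unit φ * pull B (baseMap φ) (t Y) = t X
  obj_of_hom _ h := ⟨h.1, h.2.1⟩
  hom_id h := ⟨h, h, rfl, rfl, by
    show (1 : B.obj _) * pull B (𝟙 _) (t _) = t _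
    rw [pull_id, one_mul]⟩
  hom_comp φ ψ hφ hψ := by
    obtain ⟨hX, -, hn, hd, hu⟩ := hφ
    obtain ⟨-, hZ, hn', hd', hu'⟩ := hψ
    refine ⟨hX, hZ, ?_, ?_, ?_⟩
    · rw [degFr_comp, hn, hn', mul_one]
    · rw [div_comp_pull, hd', map_one, one_mul, hd, one_pow]
    · rw [unit_comp_pull, hn', PNat.one_coe, pow_one, baseMap_comp, pull_comp, ← hu, ← hu', map_mul]
      ac_rfl

/-- The arrows of `P` commute with the Frobenius endomorphisms: for `φ = (1, f, 0, u) : A → B` in `P`,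
`φ ≫ (n, id, 0, t_B^{n-1}) = (n, id, 0, t_A^{n-1}) ≫ φ` (both have unit `u^n · f^*(t_B)^{n-1}`).
[cite: MochizukiFrdI2008, Thm. 5.2 p.101] -/
theorem twistFrob_naturality {X Y : ModelFrobenioid Φ B DivB} (φ : X ⟶ Y)
    (h : (twistPresection t R).hom φ) (hX : X.cls = divB Φ B DivB (op X.base) (t X))
    (hY : Y.cls = divB Φ B DivB (op Y.base) (t Y)) (n : ℕ+) :
    φ ≫ twistFrob t Y hY n = twistFrob t X hX n ≫ φ := by
  obtain ⟨-, -, hn, hd, hu⟩ := h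
  refine hom_ext ?_ ?_ ?_ ?_
  · show n * degFr φ = degFr φ * n
    rw [mul_comm]
  · show baseMap φ ≫ 𝟙 _ = 𝟙 _ ≫ baseMap φ
    rw [Category.comp_id, Category.id_comp]
  · show pull Φ (baseMap φ) 1 * div φ ^ (n : ℕ) =
      pull Φ (𝟙 _) (div φ) * (1 : Φ.obj (op X.base)) ^ (degFr φ : ℕ)
    simp only [hd, map_one, one_pow, mul_one]
  · show pull B (baseMap φ) (t Y ^ ((n : ℕ) - 1)) * unit φ ^ (n : ℕ) =
      pull B (𝟙 _) (unit φ) * (t X ^ ((n : ℕ) - 1)) ^ (degFr φ : ℕ)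
    have hpow : unit φ ^ (n : ℕ) = unit φ * unit φ ^ ((n : ℕ) - 1) := by
      rw [← pow_succ', Nat.sub_add_cancel (show 1 ≤ (n : ℕ) from n.pos)]
    rw [hn, PNat.one_coe, pow_one, pull_id, ← hu, mul_pow, ← map_pow, hpow]
    ac_rfl

/-- The Frobenius-section `F : ℕ_{≥1} → End(P ↪ C)`, `n ↦ ((n, id, 0, t_A^{n-1}))_A`, when the objects
of `P` are principal with trivializations `t`. [cite: MochizukiFrdI2008, Thm. 5.2 p.101] -/
def twistFrobeniusSection (hR : ∀ X, R X → X.cls = divB Φ B DivB (op X.base) (t X)) :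
    ℕ+ →* End (twistPresection t R).ι where
  toFun n :=
    { app := fun A => twistFrob t ((twistPresection t R).ι.obj A) (hR A.1 A.2) n
      naturality := fun A A' f => twistFrob_naturality t R f.1 f.2 (hR A.1 A.2) (hR A'.1 A'.2) n }
  map_one' := by
    apply NatTrans.ext
    funext A
    exact twistFrob_one t A.1 (hR A.1 A.2)
  map_mul' m n := by
    apply NatTrans.ext
    funext A
    exact twistFrob_mul t A.1 (hR A.1 A.2) m n

/-! ### The twisted section is a base-Frobenius pair -/

section Pair

variable {t R}
variable (hΦd : Objectwise (fun M _ => IsDivisorial M) Φ)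
  (hBg : Objectwise (fun M _ => IsGroupLike M) B)
  (hR₁ : ∀ X, R X → X.cls = divB Φ B DivB (op X.base) (t X))
  (hR₂ : ∀ X Y, R X → R Y → Nonempty (X.base ≅ Y.base) → X = Y)
  (hR₃ : ∀ Y₀ : D, ∃ X, R X ∧ Nonempty (X.base ≅ Y₀))

include hBg in
/-- `P ↪ C → D` is faithful: two arrows `(1, f, 0, u)`, `(1, f, 0, u')` of `P` over the same `f` have
`u · f^*(t_B) = t_A = u' · f^*(t_B)`, hence `u = u'` (`B` integral). [cite: MochizukiFrdI2008, Thm. 5.2 p.101] -/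
theorem twistPresection_toBase_faithful :
    ((twistPresection t R).toBase (toElem Φ B DivB)).Faithful := by
  refine ⟨fun {X Y} {f g} h => ?_⟩
  have h' : baseMap f.1 = baseMap g.1 := h
  obtain ⟨-, -, hn, hd, hu⟩ := f.2
  obtain ⟨-, -, hn', hd', hu'⟩ := g.2
  haveI : IsCancelMul (B.obj (op X.1.base)) :=
    isIntegral_iff_isCancelMul.mp (hBg X.1.base).isPreDivisorial.isIntegral
  rw [h'] at hu
  exact Subtype.ext
    (hom_ext (hn.trans hn'.symm) h' (hd.trans hd'.symm) (mul_right_cancel (hu.trans hu'.symm)))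

include hBg hR₁ in
/-- `P ↪ C → D` is full: `f : A_D → B_D` lifts to `(1, f, 0, t_A · f^*(t_B)⁻¹)` (`B` group-like).
[cite: MochizukiFrdI2008, Thm. 5.2 p.101] -/
theorem twistPresection_toBase_full :
    ((twistPresection t R).toBase (toElem Φ B DivB)).Full := by
  refine ⟨fun {X Y} d => ?_⟩
  let d₀ : X.1.base ⟶ Y.1.base := d
  obtain ⟨w, hw⟩ := (hBg X.1.base).isUnit (pull B d₀ (t Y.1))
  refine ⟨⟨mkHom X.1 Y.1 1 d₀ 1 (t X.1 * ↑w⁻¹) ?_, ⟨X.2, Y.2, rfl, rfl, ?_⟩⟩, rfl⟩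
  · rw [PNat.one_coe, pow_one, map_one, mul_one, hR₁ _ X.2, hR₁ _ Y.2, pullGp_divB_pull, ← hw,
      ← map_mul, mul_left_comm, Units.mul_inv, mul_one]
  · show t X.1 * ↑w⁻¹ * pull B d₀ (t Y.1) = t X.1
    rw [← hw, mul_assoc, Units.inv_mul, mul_one]

include hR₃ in
/-- `P ↪ C → D` is essentially surjective: `R` has an object over every isomorphism class of `D`.
[cite: MochizukiFrdI2008, Thm. 5.2 p.101] -/
theorem twistPresection_toBase_essSurj :
    ((twistPresection t R).toBase (toElem Φ B DivB)).EssSurj :=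
  ⟨fun Y₀ => by
    obtain ⟨X, hX, ⟨e⟩⟩ := hR₃ Y₀
    exact ⟨⟨X, hX⟩, ⟨e⟩⟩⟩

include hR₂ in
/-- `P` is a skeleton: isomorphic objects of `P` have isomorphic bases, hence are EQUAL (`R` picks one
object over each isomorphism class of `D`). [cite: MochizukiFrdI2008, Thm. 5.2 p.101] -/
theorem twistPresection_isSkeleton : (twistPresection t R).IsSkeleton := by
  rintro ⟨X, hX⟩ ⟨Y, hY⟩ ⟨e⟩
  have e' : X.base ≅ Y.base := (baseFunctor Φ B DivB).mapIso ((twistPresection t R).ι.mapIso e)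
  obtain rfl : X = Y := hR₂ X Y hX hY ⟨e'⟩
  rfl

include hΦd hBg hR₂ hR₃ in
/-- **Proof of Thm. 5.2, observation (p. 101), twisted form**: the unit-conjugated zero section over a
system of representatives and its Frobenius endomorphisms `(n, id, 0, t_A^{n-1})` form a base-Frobenius
pair of the model Frobenioid (Def. 2.7 (iii)), for `Φ` divisorial and `B` group-like.
[cite: MochizukiFrdI2008, Thm. 5.2 p.101] -/
theorem isBaseFrobeniusPair_twist :
    PreFrobenioid.IsBaseFrobeniusPair (toElem Φ B DivB) (twistPresection t R)
      (twistFrobeniusSection t R hR₁) where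
  isBaseSection :=
    { hom_pullback := fun _ h => isPullbackMorphism_of hΦd hBg h.2.2.1 h.2.2.2.1
      isSkeleton := twistPresection_isSkeleton hR₂
      isFrobeniusTrivial := fun X hX => isFrobeniusTrivial_of_cls_eq_divB t hBg X (hR₁ X hX)
      isEquivalence := by
        haveI := twistPresection_toBase_faithful (t := t) (R := R) hBg
        haveI := twistPresection_toBase_full (t := t) (R := R) hBg hR₁
        haveI := twistPresection_toBase_essSurj (t := t) (R := R) hR₃
        exact {} }
  isFrobeniusSection :=
    { degFr_eq := fun _ _ => rfl
      isBaseIdentity := fun _ _ => rfl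
      isFrobeniusType := fun _ A =>
        ⟨⟨isCoAngular hBg _, rfl⟩, show IsIso (𝟙 A.1.base) from inferInstance⟩ }

end Pair

/-! ### Representatives pinned at two objects, trivializations pinned along a morphism -/

section Through

variable (hΦd : Objectwise (fun M _ => IsDivisorial M) Φ) (hBg : Objectwise (fun M _ => IsGroupLike M) B)
  (A' A₀ : ModelFrobenioid Φ B DivB)

open Classical in
/-- Representatives of the isomorphism classes of `D` in `C`, PINNED at `A₀` and `A'`: over the class of
`Base(A₀)` the object `A₀`, over the class of `Base(A')` (if different) the object `A'`, and over any other
class the zero object `(A_D, 0)` on Mathlib's chosen representative `A_D` ("we may assume … that `C` is a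
skeleton", p. 102). [cite: MochizukiFrdI2008, Thm. 5.2 p.102] -/
def pinRep (Y : D) : ModelFrobenioid Φ B DivB :=
  if Nonempty (Y ≅ A₀.base) then A₀
  else if Nonempty (Y ≅ A'.base) then A' else zeroObj Φ B DivB ((fromSkeleton D).obj (toSkeleton Y))

/-- `pinRep` only depends on the isomorphism class. [cite: MochizukiFrdI2008, Thm. 5.2 p.102] -/
theorem pinRep_congr {Y Y' : D} (e : Y ≅ Y') : pinRep A' A₀ Y = pinRep A' A₀ Y' := by
  unfold pinRep
  by_cases h₀ : Nonempty (Y ≅ A₀.base)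
  · rw [if_pos h₀, if_pos (⟨e.symm ≪≫ h₀.some⟩ : Nonempty (Y' ≅ A₀.base))]
  · have h₀' : ¬ Nonempty (Y' ≅ A₀.base) := fun ⟨i⟩ => h₀ ⟨e ≪≫ i⟩
    rw [if_neg h₀, if_neg h₀']
    by_cases h₁ : Nonempty (Y ≅ A'.base)
    · rw [if_pos h₁, if_pos (⟨e.symm ≪≫ h₁.some⟩ : Nonempty (Y' ≅ A'.base))]
    · have h₁' : ¬ Nonempty (Y' ≅ A'.base) := fun ⟨i⟩ => h₁ ⟨e ≪≫ i⟩
      rw [if_neg h₁, if_neg h₁', congr_toSkeleton_of_iso e]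

/-- The representative over `Y` lies over `Y` (up to isomorphism). [cite: MochizukiFrdI2008, Thm. 5.2 p.102] -/
theorem nonempty_pinRep_base_iso (Y : D) : Nonempty ((pinRep A' A₀ Y).base ≅ Y) := by
  unfold pinRep
  split_ifs with h₀ h₁
  · exact ⟨h₀.some.symm⟩
  · exact ⟨h₁.some.symm⟩
  · exact ⟨fromSkeletonToSkeletonIso Y⟩

/-- The values of `pinRep`. [cite: MochizukiFrdI2008, Thm. 5.2 p.102] -/
theorem pinRep_cases (Y : D) :
    pinRep A' A₀ Y = A₀ ∨ pinRep A' A₀ Y = A' ∨ ∃ Y', pinRep A' A₀ Y = zeroObj Φ B DivB Y' := by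
  unfold pinRep
  split_ifs
  · exact Or.inl rfl
  · exact Or.inr (Or.inl rfl)
  · exact Or.inr (Or.inr ⟨_, rfl⟩)

/-- `A₀` is the representative over its own base. [cite: MochizukiFrdI2008, Thm. 5.2 p.102] -/
theorem pinRep_base_right : pinRep A' A₀ A₀.base = A₀ := by
  unfold pinRep
  rw [if_pos ⟨Iso.refl _⟩]

/-- `A'` is the representative over its own base when the two pinned bases are not isomorphic.
[cite: MochizukiFrdI2008, Thm. 5.2 p.102] -/
theorem pinRep_base_left (hne : ¬ Nonempty (A'.base ≅ A₀.base)) : pinRep A' A₀ A'.base = A' := by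
  unfold pinRep
  rw [if_neg hne, if_pos ⟨Iso.refl _⟩]

/-- The class `R` of representatives: `X` is THE pinned representative over its base.
[cite: MochizukiFrdI2008, Thm. 5.2 p.102] -/
def IsPinRep (X : ModelFrobenioid Φ B DivB) : Prop := X = pinRep A' A₀ X.base

/-- Representatives with isomorphic bases are equal. [cite: MochizukiFrdI2008, Thm. 5.2 p.102] -/
theorem IsPinRep.eq_of_iso {X Y : ModelFrobenioid Φ B DivB} (hX : IsPinRep A' A₀ X) (hY : IsPinRep A' A₀ Y)
    (e : X.base ≅ Y.base) : X = Y := by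
  rw [hX, hY]
  exact pinRep_congr A' A₀ e

/-- Every `Y ∈ Ob(D)` is (up to isomorphism) the base of a representative.
[cite: MochizukiFrdI2008, Thm. 5.2 p.102] -/
theorem exists_isPinRep (Y₀ : D) : ∃ X, IsPinRep A' A₀ X ∧ Nonempty (X.base ≅ Y₀) := by
  obtain ⟨e⟩ := nonempty_pinRep_base_iso A' A₀ Y₀
  exact ⟨pinRep A' A₀ Y₀, (pinRep_congr A' A₀ e).symm, ⟨e⟩⟩

open Classical in
/-- A trivialization of every principal object: some `t_A ∈ B(A_D)` with `Div_B(t_A) = α` when it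
exists (`1` otherwise). [cite: MochizukiFrdI2008, Thm. 5.2 p.101] -/
def triv₀ (X : ModelFrobenioid Φ B DivB) : B.obj (op X.base) :=
  if h : ∃ b : B.obj (op X.base), X.cls = divB Φ B DivB (op X.base) b then h.choose else 1

/-- `triv₀` trivializes every principal object. [cite: MochizukiFrdI2008, Thm. 5.2 p.101] -/
theorem cls_eq_divB_triv₀ {X : ModelFrobenioid Φ B DivB}
    (h : ∃ b : B.obj (op X.base), X.cls = divB Φ B DivB (op X.base) b) :
    X.cls = divB Φ B DivB (op X.base) (triv₀ X) := by
  unfold triv₀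
  rw [dif_pos h]
  exact h.choose_spec

variable {A' A₀} (φ : A' ⟶ A₀)

/-- The trivializations PINNED ALONG `φ : A' → A₀`: `triv₀` except at `A'`, where it is
`u_φ · Base(φ)^*(t_{A₀})` — so that `φ` itself becomes an arrow of the twisted section (the unit
conjugation of [FrdI] Prop. 5.6 "up to conjugation by a unit"). [cite: MochizukiFrdI2008, Prop. 5.6 p.105] -/
def trivThrough : ∀ X : ModelFrobenioid Φ B DivB, B.obj (op X.base) := by
  classical exact Function.update triv₀ A' (unit φ * pull B (baseMap φ) (triv₀ A₀))

variable (hn : degFr φ = 1) (hd : div φ = 1)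
  (hA₀ : ∃ b : B.obj (op A₀.base), A₀.cls = divB Φ B DivB (op A₀.base) b)

include hn hd hA₀ in
/-- The source of a linear `Div`-free morphism into a principal object is principal:
`α' = Base(φ)^* α₀ + Div_B(u_φ) = Div_B(Base(φ)^* b₀ · u_φ)`. [cite: MochizukiFrdI2008, Thm. 5.2 p.101] -/
theorem exists_cls_eq_divB_source :
    ∃ b : B.obj (op A'.base), A'.cls = divB Φ B DivB (op A'.base) b := by
  obtain ⟨b₀, hb₀⟩ := hA₀
  have h := rel φ
  rw [hn, hd, PNat.one_coe, pow_one, map_one, mul_one, hb₀, pullGp_divB_pull, ← map_mul] at h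
  exact ⟨_, h⟩

include hn hd hA₀ in
/-- Every pinned representative is principal, trivialized by `trivThrough φ`.
[cite: MochizukiFrdI2008, Thm. 5.2 p.101] -/
theorem cls_eq_divB_trivThrough (hne : ¬ Nonempty (A'.base ≅ A₀.base)) (X : ModelFrobenioid Φ B DivB)
    (hX : IsPinRep A' A₀ X) : X.cls = divB Φ B DivB (op X.base) (trivThrough φ X) := by
  classical
  by_cases hXA : X = A'
  · subst hXA
    rw [trivThrough, Function.update_self, map_mul, ← pullGp_divB_pull, ← cls_eq_divB_triv₀ hA₀]
    have h := rel φ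
    rw [hn, hd, PNat.one_coe, pow_one, map_one, mul_one] at h
    rw [h, mul_comm]
  · rw [trivThrough, Function.update_of_ne hXA]
    apply cls_eq_divB_triv₀
    rcases pinRep_cases A' A₀ X.base with h | h | ⟨Y', h⟩
    · rw [hX, h]; exact hA₀
    · exact absurd (hX.trans h) hXA
    · rw [hX, h]; exact ⟨1, by rw [map_one]⟩

include hΦd hBg hn hd hA₀ in
/-- **A base-Frobenius pair through a prescribed pull-back morphism** (Thm. 5.2 proof p. 101 with the
unit conjugation of Prop. 5.6): for `Φ` divisorial, `B` group-like, a linear morphism `φ : A' → A₀` with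
`Div(φ) = 0` into a principal (e.g. Frobenius-trivial) object `A₀`, such that `Base(A')` and `Base(A₀)`
are NOT isomorphic, there is a base-Frobenius pair `(P, F)` of the model Frobenioid (Def. 2.7 (iii)) for
which `φ` is `P`-distinguished (in particular `A', A₀ ∈ Ob(P)`).  (Def. 2.7 (i)(a) forbids the case of
isomorphic bases unless `A' = A₀`: objects of a base-section with isomorphic bases are equal.)
[cite: MochizukiFrdI2008, Thm. 5.2 p.101] -/
theorem exists_isBaseFrobeniusPair_through (hne : ¬ Nonempty (A'.base ≅ A₀.base)) :
    ∃ (P : Presection (ModelFrobenioid Φ B DivB)) (Fr : ℕ+ →* End P.ι),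
      PreFrobenioid.IsBaseFrobeniusPair (toElem Φ B DivB) P Fr ∧ P.hom φ := by
  classical
  have hR₁ := cls_eq_divB_trivThrough φ hn hd hA₀ hne
  refine ⟨twistPresection (trivThrough φ) (IsPinRep A' A₀),
    twistFrobeniusSection (trivThrough φ) (IsPinRep A' A₀) hR₁,
    isBaseFrobeniusPair_twist hΦd hBg hR₁ (fun X Y hX hY ⟨e⟩ => hX.eq_of_iso A' A₀ hY e)
      (exists_isPinRep A' A₀), ?_, ?_, hn, hd, ?_⟩
  · exact (pinRep_base_left A' A₀ hne).symm
  · exact (pinRep_base_right A' A₀).symm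
  · have hA : A₀ ≠ A' := by
      rintro rfl
      exact hne ⟨Iso.refl _⟩
    show unit φ * pull B (baseMap φ) (Function.update triv₀ A' (unit φ * pull B (baseMap φ) (triv₀ A₀)) A₀) =
      Function.update triv₀ A' (unit φ * pull B (baseMap φ) (triv₀ A₀)) A'
    rw [Function.update_self, Function.update_of_ne hA]

end Through

/-- **Every principal object lies in a base-section**: for `Φ` divisorial, `B` group-like and a principal
(e.g. Frobenius-trivial, `exists_cls_eq_divB_of_isFrobeniusTrivial`) object `A₀`, there is a
base-Frobenius pair `(P, F)` of the model Frobenioid with `A₀ ∈ Ob(P)` — cf. Prop. 5.6 "Let `A ∈ Ob(P)`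
be a Frobenius-trivial object". [cite: MochizukiFrdI2008, Prop. 5.6 p.105] -/
theorem exists_isBaseFrobeniusPair_obj (hΦd : Objectwise (fun M _ => IsDivisorial M) Φ)
    (hBg : Objectwise (fun M _ => IsGroupLike M) B) (A₀ : ModelFrobenioid Φ B DivB)
    (hA₀ : ∃ b : B.obj (op A₀.base), A₀.cls = divB Φ B DivB (op A₀.base) b) :
    ∃ (P : Presection (ModelFrobenioid Φ B DivB)) (Fr : ℕ+ →* End P.ι),
      PreFrobenioid.IsBaseFrobeniusPair (toElem Φ B DivB) P Fr ∧ P.obj A₀ := by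
  have hR₁ : ∀ X, IsPinRep A₀ A₀ X → X.cls = divB Φ B DivB (op X.base) (triv₀ X) := by
    intro X hX
    apply cls_eq_divB_triv₀
    rcases pinRep_cases A₀ A₀ X.base with h | h | ⟨Y', h⟩
    · rw [hX, h]; exact hA₀
    · rw [hX, h]; exact hA₀
    · rw [hX, h]; exact ⟨1, by rw [map_one]⟩
  exact ⟨twistPresection triv₀ (IsPinRep A₀ A₀), twistFrobeniusSection triv₀ (IsPinRep A₀ A₀) hR₁,
    isBaseFrobeniusPair_twist hΦd hBg hR₁ (fun X Y hX hY ⟨e⟩ => hX.eq_of_iso A₀ A₀ hY e)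
      (exists_isPinRep A₀ A₀), (pinRep_base_right A₀ A₀).symm⟩

end ModelFrobenioid

end Literature.AlgebraicGeometry.Frobenioids
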